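import Summits.NavierStokesRegularity.OSWSelfSimilar.SheetNSLineTorusCascadeWiener
import HarnessLib

/-!
# Viscous CLM on the torus (`a = 0`, `σ = 2`): time shifts of the cascade — the restarted cascade at time `T` is a
# nonnegative-datum cascade, so the Wiener/Riccati theorems apply from any later time (the hand-over step of the certificate)

HONEST FRAMING (cell ns-blowup GROUP B «PROFILE SEARCH», zone Z3, row Z3-U addendum A-F2 of `HOME/profile/z3/CENSUS-Z3.md`;
human rulings D-0035/D-0074): **1-D MODEL (viscous Constantin–Lax–Majda equation on `𝕋`); ODE calculus on Fourier-coefficient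
families, kernel-checked; not Euler, not Navier–Stokes; «violates: none — MODEL».**

OBJECT. The cascade ODE `ċ_k = ½ Σ_{i+j=k} c_i c_j − ν k² c_k` is autonomous, so `t ↦ c_k(t + T)` (`T ≥ 0`) is again a cascade,
with datum `c_k(T) ≥ 0`: `IsNonnegCascade.shift`, `IsSineCascade.shift_isNonnegCascade`. Consequently the Wiener-threshold
theorem restarts at any time: `IsNonnegCascade.partialSum_le_of_wiener_shift` — **if at some `T ≥ 0` the first mode is present and
`Σ_{k≤K} c_k(T) ≤ W < 2ν` for all `K`, then `Σ_{k≤K} c_k(t) ≤ (2νW/(2ν − W)) e^{−ν(t−T)}` for all `t ≥ T`** — the HAND-OVER step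
of the global-existence certificate (`HOME/profile/z3/SHEET.md` §15.8–15.9: the certified bound `Σ_k c^k e_k(T) ≤ 1.255 < 2` at
`νT = 3`), previously a pen sentence. bears_on: LADDER-NS N5 / zone Z3 (row Z3-U) → N1 linear core. WHAT THIS IS NOT: not NS;
no PDE object. No definitions.
-/

namespace Summit.NavierStokesRegularity.OSWSelfSimilar
namespace SheetNSLineTorusCascade

open Finset Real Set

variable {ν c : ℝ} {e : ℕ → ℝ → ℝ}

/-- **Time shift of a nonnegative cascade.** If `e` is a nonnegative-datum cascade then so is `(k, t) ↦ e k (t + T)` for every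
`T ≥ 0`. [new here — MODEL] -/
theorem IsNonnegCascade.shift (he : IsNonnegCascade ν e) {T : ℝ} (hT : 0 ≤ T) :
    IsNonnegCascade ν (fun k t => e k (t + T)) where
  zero t := he.zero (t + T)
  cont k := by
    refine (he.cont k).comp (continuous_add_const T).continuousOn (fun t ht => ?_)
    exact le_trans hT (by simpa using add_le_add_right (show (0:ℝ) ≤ t from ht) T)
  ode k t ht := by
    have h := he.ode k (t + T) (by linarith)
    have hcomp := h.comp t ((hasDerivAt_id t).add_const T)
    simp only [id_eq, mul_one] at hcomp
    exact hcomp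
  init_nonneg k := by simpa using he.nonneg k T hT

/-- **Time shift of the sine-datum cascade** (`c ≥ 0`): the restarted family at `T ≥ 0` is a nonnegative-datum cascade.
[new here — MODEL] -/
theorem IsSineCascade.shift_isNonnegCascade (he : IsSineCascade ν c e) (hc : 0 ≤ c) {T : ℝ} (hT : 0 ≤ T) :
    IsNonnegCascade ν (fun k t => e k (t + T)) :=
  (he.isNonnegCascade hc).shift hT

/-- **WIENER THRESHOLD RESTARTED AT TIME `T` (the hand-over step).** If `e` is a nonnegative cascade, `T ≥ 0`, the first mode is
present at `T` (`c_1(T) > 0`), and `Σ_{k≤K} c_k(T) ≤ W < 2ν` for every `K`, then for all `K` and `t ≥ T`: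
`Σ_{k≤K} c_k(t) ≤ (2νW/(2ν − W))·e^{−ν(t−T)}`. [new here — MODEL] -/
theorem IsNonnegCascade.partialSum_le_of_wiener_shift (he : IsNonnegCascade ν e) (hν : 0 < ν) {T : ℝ} (hT : 0 ≤ T)
    (h1 : 0 < e 1 T) {W : ℝ} (hW : W < 2 * ν) (hdata : ∀ K, ∑ k ∈ range (K + 1), e k T ≤ W)
    (K : ℕ) (t : ℝ) (ht : T ≤ t) :
    ∑ k ∈ range (K + 1), e k t ≤ 2 * ν * W / (2 * ν - W) * exp (-(ν * (t - T))) := by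
  have hs := he.shift hT
  have h1' : 0 < (fun k t => e k (t + T)) 1 0 := by simpa using h1
  have hdata' : ∀ K, ∑ k ∈ range (K + 1), (fun k t => e k (t + T)) k 0 ≤ W := by
    intro K'; simpa using hdata K'
  have h := hs.partialSum_le_of_wiener hν h1' hW hdata' K (t - T) (by linarith)
  simpa [sub_add_cancel] using h

end SheetNSLineTorusCascade
end Summit.NavierStokesRegularity.OSWSelfSimilar
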